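import Summits.ResolutionOfSingularities.ResolutionOfSingularities.Theses.FoliationDescent
import Summits.ResolutionOfSingularities.ResolutionOfSingularities.Theorems.FoliationDescentDualSandwichRelStep
import Summits.ResolutionOfSingularities.ResolutionOfSingularities.Theorems.FoliationDescentDualSandwichFrobeniusTop
import Summits.ResolutionOfSingularities.ResolutionOfSingularities.Theorems.FoliationDescentDualSandwichRelChain
import HarnessLib

/-!
# Crux `DualSandwich` (stmt-ResolutionOfSingularities-17083) — line `birth`, lead's skeleton (v2)

Route `ResolutionOfSingularities/FoliationDescent`, crux #4 (rank 4, difficulty M, "consumed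
reduction"): `DualSandwich := FolLU → LogCanQuotLU → TorsorLUPerfect` — foliation local
uniformization (`FolLU`) and log-canonical quotient uniformization (`LogCanQuotLU`) give local
uniformization of `α_p`-torsors `t ^ p = a` over bases `A₀` regular at the centre, over PERFECT
ground fields, by the DOUBLE (reverse Frobenius) SANDWICH `K = K₀(t) ⊆ K₀^{1/p} ⊇ A₀^{1/p}` and
`n − 1` purely inseparable DESCENTS of degree `p`.

v2 (lead, 2026-08-17): same cut as the planner's birth skeleton (sha 6dc986c0…: three stubs
`stub_relStep`, `stub_frobeniusTop`, `stub_relChain`, composition proved), RESHAPED ONLY IN FORM: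
the three auxiliary predicates `RelStep p`, `RelChain p`, `FrobeniusTop` are UNFOLDED into the stub
signatures (so that the stub files under `Theorems/` state the registered signatures verbatim
without a reviewed `…BirthDefs.lean`, and the final crux file declares no `def`). The mathematics
and the composition are unchanged.

## The cut

Everything is RELATIVE (models must dominate a given finitely generated `R`, here `R = k[A₀, t]`)
and REGULAR AT THE CENTRE only (never `IsRegularRing`), exactly as the route's items are typed.

* `stub_relStep` — `FolLU → LogCanQuotLU →` **one relative descent step below a height-one simple
  sandwich**: `k` perfect of characteristic `p`, `K ⊆ L = K(y)` purely inseparable with `y ^ p ∈ K`,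
  `O` a valuation ring of `L`, `B ⊆ O` a finitely generated `k`-subalgebra with `Frac B = L`,
  regular at the centre of `O`, and `R ⊆ K` finitely generated with `R ⊆ B`: then some finitely
  generated `A ⊆ O ∩ K` with `R ⊆ A`, `Frac A = K`, regular at the centre of `O ∩ K`. The DUAL
  reading: `L = K(y)` is the kernel extension of the `p`-closed derivation `D = d/dy`; `FolLU`
  refines `B` to `S'`, `LogCanQuotLU` WITH THE GIVEN `R` returns the constants model. (CLOSED:
  `Theorems/FoliationDescentDualSandwichRelStep.lean`, p165800, from the crux-attack refuter's candidate.)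
* `stub_relChain` — the step for `L = K(y)` ⇒ **relative descent along any FINITE purely
  inseparable `L/K`**: degree-`p` chains + induction on `[L : K]`, peeling from the bottom
  (`exists_not_mem_range_pow_mem_range`), the SAME `R` throughout (pattern:
  `isLocallyUniformizable_comap_of_rrLU1`, `Theorems/PAlterationPialtSqueezeRRLU1.lean`). (CLOSED:
  `Theorems/FoliationDescentDualSandwichRelChain.lean`, p165934.)
* `stub_frobeniusTop` — **the regular Frobenius top of a torsor datum over a PERFECT field**: for
  the data of `TorsorLUPerfect` there are a finite purely inseparable `L ⊇ K`, a valuation ring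
  `O'` of `L` with `O' ∩ K = O`, a finitely generated `B ⊆ O'` with `Frac B = L`, regular at the
  centre of `O'`, and a finitely generated `R` with `k[A₀, t] ⊆ R ⊆ B ∩ K`. Witness:
  `L = K(a₁^{1/p}, …, a_m^{1/p}) ⊆ K̄` (`A₀ = k[a₁, …, a_m]`), `O' = Frob⁻¹ O` (exponent one),
  `B = k[a₁^{1/p}, …, a_m^{1/p}] ≅ A₀` by Frobenius (finitely generated and `∋ t` BECAUSE `k` is
  perfect), `R = k[A₀, t]`. (CLOSED: `Theorems/FoliationDescentDualSandwichFrobeniusTop.lean`, p165876.)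
* `DualSandwich_proof : DualSandwich` — the composition, PROVED (no `sorry` of its own): take the
  Frobenius top, `subst O = O' ∩ K`, run the chain fed by the step, read off `A ⊇ A₀ ∋ t`.

Disproof used: `Cruxes/DualSandwich/Disproof.lean` v3 (cdisprove gen 1+2): every stub is
summit-implied (no stub is refutable short of `¬ Res_p`); §5 NAIVE DESCENT IS FALSE
(`Theorems/DualSandwich/Negative/NaiveDescent.lean`): the trace `B ∩ K` of the regular top is NOT
regular at the centre in general, so every degree-`p` step must consume `FolLU`+`LogCanQuotLU`
(as `stub_relStep` does) and `A := B.comap _` is used only in the base case `K = L` of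
`stub_relChain`. Which hypothesis is used where: `FolLU`/`LogCanQuotLU` enter ONLY through
`stub_relStep`; perfectness of `k` is load-bearing only in `stub_frobeniusTop`.
-/

noncomputable section

-- single-problem summit: the doubled namespace component `ResolutionOfSingularities` is forced
set_option linter.dupNamespace false

open Summit.ResolutionOfSingularities.ResolutionOfSingularities.Theses.FoliationDescent
  (FolLU LogCanQuotLU TorsorLUPerfect DualSandwich)

namespace Summit.ResolutionOfSingularities.ResolutionOfSingularities.Cruxes.DualSandwich.Lines.Birth

/-! ## The stubs (signatures fully unfolded; the `Theorems/` stub files state them verbatim) -/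

/-- **STUB (load-bearing use of the route's cruxes; size M).** One relative descent step below a
height-one simple sandwich `K ⊆ L = K(y)`, `y ^ p ∈ K`, keeping the given finitely generated
`R ⊆ K`: `D = d/dy` (`D^[p] = 0`, `ker D = K`); `FolLU` refines the regular-at-the-centre model
`B ⊇ R` to `S'` with `g • D` non-singular or multiplicative, `LogCanQuotLU` with the given `R`
(`D|_R = 0`) returns `A ⊇ R` of `D`-constants, `Frac A = ker D = K`, regular at the centre;
transport to `K`. [cite: Temkin2013, Rem. 1.3.5 (ii)–(iii)] -/
theorem stub_relStep (hF : FolLU) (hQ : LogCanQuotLU) (p : ℕ) (hp : p.Prime) :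
    ∀ (k K L : Type) [Field k] [CharP k p] [PerfectField k] [Field K] [Field L] [Algebra k K]
      [Algebra K L] [Algebra k L] [IsScalarTower k K L], IsPurelyInseparable K L →
      (∃ y : L, y ^ p ∈ (algebraMap K L).range ∧ IntermediateField.adjoin K {y} = ⊤) →
      ∀ (O : ValuationSubring L) (B : Subalgebra k L) (hB : B.toSubring ≤ O.toSubring)
        (R : Subalgebra k K), B.FG → IsFractionRing B L →
        IsRegularLocalRing (Localization.AtPrime
          (Ideal.comap (Subring.inclusion hB) (IsLocalRing.maximalIdeal O))) →
        R.FG → R.map (IsScalarTower.toAlgHom k K L) ≤ B →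
        ∃ (A : Subalgebra k K) (hA : A.toSubring ≤ (O.comap (algebraMap K L)).toSubring),
          R ≤ A ∧ A.FG ∧ IsFractionRing A K ∧
          IsRegularLocalRing (Localization.AtPrime
            (Ideal.comap (Subring.inclusion hA)
              (IsLocalRing.maximalIdeal (O.comap (algebraMap K L))))) :=
  -- CLOSED: landed as `Theorems/FoliationDescentDualSandwichRelStep.lean` (p165800)
  Summit.ResolutionOfSingularities.ResolutionOfSingularities.Theorems.DualSandwich.Birth.stub_relStep
    hF hQ p hp

/-- **STUB (true, size M; perfectness of `k` is used here).** The regular Frobenius top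
`K ⊆ K(a₁^{1/p}, …, a_m^{1/p}) ⊇ k[a₁^{1/p}, …, a_m^{1/p}] ≅ A₀` of a torsor datum over a perfect
field, with the extended valuation ring `{x | x ^ p ∈ O}` and `R = k[A₀, t]`: for `k` perfect of
characteristic `p`, `O` a valuation ring of `K`, `A₀ ⊆ O` finitely generated and regular at the
centre of `O`, `t ^ p ∈ A₀` and `K = Frac k[A₀, t]`, there are a finite purely inseparable field
extension `L ⊇ K`, a valuation ring `O'` of `L` with `O' ∩ K = O`, a finitely generated
`k`-subalgebra `B ⊆ O'` of `L` with `Frac B = L`, regular at the centre of `O'`, and a finitely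
generated `R ⊆ K` with `A₀ ⊆ R ∋ t` and `R ⊆ B`.
[cite: Temkin2013, §1.3 (Frobenius transport over perfect fields)] -/
theorem stub_frobeniusTop :
    ∀ p : ℕ, p.Prime → ∀ (k K : Type) [Field k] [CharP k p] [PerfectField k] [Field K]
      [Algebra k K] (O : ValuationSubring K) (A₀ : Subalgebra k K)
      (h₀ : A₀.toSubring ≤ O.toSubring) (t : K), A₀.FG → t ^ p ∈ A₀ →
      IsFractionRing (Algebra.adjoin k (insert t (A₀ : Set K))) K →
      IsRegularLocalRing (Localization.AtPrime
        (Ideal.comap (Subring.inclusion h₀) (IsLocalRing.maximalIdeal O))) →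
      ∃ (L : Type) (_ : Field L) (_ : Algebra k L) (_ : Algebra K L) (_ : IsScalarTower k K L)
        (_ : FiniteDimensional K L) (_ : IsPurelyInseparable K L) (O' : ValuationSubring L)
        (B : Subalgebra k L) (hB : B.toSubring ≤ O'.toSubring) (R : Subalgebra k K),
        O'.comap (algebraMap K L) = O ∧ B.FG ∧ IsFractionRing B L ∧
        IsRegularLocalRing (Localization.AtPrime
          (Ideal.comap (Subring.inclusion hB) (IsLocalRing.maximalIdeal O'))) ∧
        A₀ ≤ R ∧ t ∈ R ∧ R.FG ∧ R.map (IsScalarTower.toAlgHom k K L) ≤ B :=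
  -- CLOSED: landed as `Theorems/FoliationDescentDualSandwichFrobeniusTop.lean` (p165876)
  Summit.ResolutionOfSingularities.ResolutionOfSingularities.Theorems.DualSandwich.Birth.stub_frobeniusTop

/-- **STUB (true, size M).** One-step relative descent ⇒ relative descent along every FINITE
purely inseparable extension `L/K` (perfect ground field `k` of characteristic `p`): degree-`p`
chains and induction on `[L : K]` — peel `y ∈ L ∖ K` with `y ^ p ∈ K` from the bottom, descend
`L / K(y)` by induction and `K(y) / K` by the step, keeping the same `R`.
[cite: Temkin2013, Thm. 1.3.2 and Rem. 1.3.5] -/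
theorem stub_relChain (p : ℕ) (hp : p.Prime)
    (h : ∀ (k K L : Type) [Field k] [CharP k p] [PerfectField k] [Field K] [Field L] [Algebra k K]
      [Algebra K L] [Algebra k L] [IsScalarTower k K L], IsPurelyInseparable K L →
      (∃ y : L, y ^ p ∈ (algebraMap K L).range ∧ IntermediateField.adjoin K {y} = ⊤) →
      ∀ (O : ValuationSubring L) (B : Subalgebra k L) (hB : B.toSubring ≤ O.toSubring)
        (R : Subalgebra k K), B.FG → IsFractionRing B L →
        IsRegularLocalRing (Localization.AtPrime
          (Ideal.comap (Subring.inclusion hB) (IsLocalRing.maximalIdeal O))) →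
        R.FG → R.map (IsScalarTower.toAlgHom k K L) ≤ B →
        ∃ (A : Subalgebra k K) (hA : A.toSubring ≤ (O.comap (algebraMap K L)).toSubring),
          R ≤ A ∧ A.FG ∧ IsFractionRing A K ∧
          IsRegularLocalRing (Localization.AtPrime
            (Ideal.comap (Subring.inclusion hA)
              (IsLocalRing.maximalIdeal (O.comap (algebraMap K L)))))) :
    ∀ (k K L : Type) [Field k] [CharP k p] [PerfectField k] [Field K] [Field L] [Algebra k K]
      [Algebra K L] [Algebra k L] [IsScalarTower k K L] [FiniteDimensional K L]
      [IsPurelyInseparable K L] (O : ValuationSubring L) (B : Subalgebra k L)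
      (hB : B.toSubring ≤ O.toSubring) (R : Subalgebra k K), B.FG → IsFractionRing B L →
      IsRegularLocalRing (Localization.AtPrime
        (Ideal.comap (Subring.inclusion hB) (IsLocalRing.maximalIdeal O))) →
      R.FG → R.map (IsScalarTower.toAlgHom k K L) ≤ B →
      ∃ (A : Subalgebra k K) (hA : A.toSubring ≤ (O.comap (algebraMap K L)).toSubring),
        R ≤ A ∧ A.FG ∧ IsFractionRing A K ∧
        IsRegularLocalRing (Localization.AtPrime
          (Ideal.comap (Subring.inclusion hA)
            (IsLocalRing.maximalIdeal (O.comap (algebraMap K L))))) :=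
  -- CLOSED: landed as `Theorems/FoliationDescentDualSandwichRelChain.lean` (p165934)
  Summit.ResolutionOfSingularities.ResolutionOfSingularities.Theorems.DualSandwich.Birth.stub_relChain
    p hp h

/-! ## The composition (kernel-checked; no `sorry` in its own term) -/

/-- **The crux `DualSandwich`, assembled from the three stubs** — given `FolLU`, `LogCanQuotLU`
and a torsor datum `(k, K, O, A₀, t)` over a perfect field, take its Frobenius top `(L, O', B, R)`
(`stub_frobeniusTop`), identify `O = O' ∩ K`, and descend from `B` along the finite purely
inseparable `L/K` (`stub_relChain` fed by `stub_relStep`) keeping `R ⊇ k[A₀, t]`: the output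
`A ⊇ R` is the wanted model (`A₀ ⊆ A ∋ t`, `Frac A = K`, regular at the centre of `O`).
[cite: Temkin2013, Thm. 1.3.2 and Rem. 1.3.5] -/
theorem DualSandwich_proof : DualSandwich := by
  intro hF hQ p hp k K _ _ _ _ _ O A₀ h₀ t hfg htp hfrac hreg
  obtain ⟨L, _, _, _, _, _, _, O', B, hB, R, hO, hBfg, hBfr, hBreg, hA₀R, htR, hRfg, hRB⟩ :=
    stub_frobeniusTop p hp k K O A₀ h₀ t hfg htp hfrac hreg
  subst hO
  obtain ⟨A, hA, hRA, hAfg, hAfr, hAreg⟩ :=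
    stub_relChain p hp (stub_relStep hF hQ p hp) k K L O' B hB R hBfg hBfr hBreg hRfg hRB
  exact ⟨A, hA, le_trans hA₀R hRA, hRA htR, hAfg, hAfr, hAreg⟩

end Summit.ResolutionOfSingularities.ResolutionOfSingularities.Cruxes.DualSandwich.Lines.Birth

end
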